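/-
Copyright: the b2b-balaban T⁴-continuum CRUX team, row NE7b leaf lineage `t4-ne7b-formalise-leaf-04` (gen 149). Project licence.
-/
import Literature.MathematicalPhysics.QuantumFieldTheory.Balaban1983to89.B1

/-!
# THREE RESISTANCES ADD: the FIBRE floor of the next averaging step — `γ‖v‖² ≤ T v + a′‖Q v‖²` with
# `γ⁻¹ = (1 + qκ)²∕A + p + κ²∕a′` — from the ONE-BIG-STEP letter `T v ≥ ⨅ χ, (A‖v − R χ‖² + B χ)` and a ONE-SCALE
# block-Poincaré letter WITH the next constraint `‖R χ‖² ≤ p·B χ + κ²‖Q (R χ)‖²`, for a fine energy `B ≥ 0` with NO floor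
# of its own (massless), on ANY fine configuration type, in any normed groups at the two levels; level-free through print's
# `a_k ≥ a(1 − L⁻²)` BY NAME (`…Balaban1983to89.B1.aSeq`)
# (row NE7b, node U5c; residual (R2′) family (2), letter (ℓ1) — the fibre floor `λ` in FORM currency; [folklore])

Cell `pub-balaban`, sub-cell `t4`, spine estimate NE7b (`T4WeightBudget.RelWeightBound`; the cell's OWN estimate — NOT PRINTED in
[Bałaban 1983–89], NOT PROVED).  Crux-route work under `Spine/NE7b/` (FREEZE (0) crux-prover clause) by leaf-04; NOTHING of Bałaban's is
asserted or valued: the one printed object touched, the sequence `a_k` of [Balaban1982Higgs1] (2.15), enters BY NAME through the tree's KERNEL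
lemmas `B1.aSeq_pos ∕ B1.ainf_lt_aSeq`; no `def`; zero `sorry`.  Imports: that BUILT Literature module (which imports Mathlib).

WHY.  This lineage's `…AveragingFloorTower` (AFT, p376805) types the SOFT averaging tower in the KEPT variable: the floor of
`x ↦ ⨅ y, (S y + a‖x − P y‖²)` is `(a⁻¹ + q²γ⁻¹)⁻¹‖x‖²` when `S ≥ γ‖·‖²` GLOBALLY, and the floors iterate with print's `a_k`.  The NE7b
ideation lens located the non-transfer (T-82 (α), `t4/ideate/NE7b/checks-g82`): AFT's input `γ₀‖y‖² ≤ S 0 y` on ALL of `E 0` is, for a massless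
fine action, the VOLUME's spectral gap — so AFT carries the `a_k` letter and a volume-dependent gap, NOT the road's `k`- and volume-uniform
FIBRE floor `λ` (the floor, in the INTEGRATED variable, of the next step's fluctuation form `v ↦ T v + a′‖Q v‖²`, print's
`Δ^{(k)} + aL⁻²Q^*Q ≥ γ₀` = [Balaban1983RegularityDecay] (1.15), PROVED for the concrete scalar torus tower in the tree as
`…B4Ineq115Torus.ineq115_lower_uniform` and read onto the road by `…ScalarTowerFibreFloor`).  T-82 §5 names the falsifier of (α): «a use of
AFT's currency where the floor is fibre ∕ volume-uniform».  THIS FILE is that use, as an abstract [folklore] theorem whose three letters are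
exactly the three inputs of the tree's concrete proof of (1.15) (its docstring «MECHANISM», `B4Ineq115Torus.lean`) and of print's p. 580 (2.27):
(i) the ONE-BIG-STEP letter — the level-`k` form `T` dominates `⨅ χ, (A‖v − R χ‖² + B χ)` with `R` the `k`-fold average from the FINE
lattice and `A = a_k` (the tree's variational identity `B4Ineq115Torus.form_Drs`: `⟨ψ, Δ^{(j)}ψ⟩ = B φ₀ + a_j‖Q_jφ₀ − ψ‖²`; AFT §4 ∕
`…BIJ85ScalarFormSemigroup`: «k soft steps = one soft step with `a_k`»); (ii) a ONE-SCALE block-Poincaré letter WITH THE NEXT CONSTRAINT —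
`‖R χ‖² ≤ p·B χ + κ²·‖Q (R χ)‖²`: the averaged field is controlled by the fine energy of `χ` AND its next-level block means (the tree's
`min{8,a}‖Q_jφ₀‖² ≤ L²·B φ₀ + a⟨Q_jφ₀, Q^*Q Q_jφ₀⟩` — block Poincaré on the composite blocks + Jensen; `Beta.BlockPoincare.coercive_of_blockPoincare`
is the `k = 0` member); here `B ≥ 0` needs NO floor of its own, which is the whole point (massless fine actions); (iii) the NEXT penalty
`a′‖Q v‖²` with `Q` `q`-Lipschitz.  From (i)–(iii), by two triangle inequalities and ONE weighted Cauchy–Schwarz step (three «resistances»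
`(1 + qκ)²∕A`, `p`, `κ²∕a′` IN SERIES), `γ⁻¹ = (1 + qκ)²∕A + p + κ²∕a′` — level-free as soon as `A = a_k ≥ a_∞ = a(1 − L⁻²)` (§5, `B1.ainf_lt_aSeq`
BY NAME) and `p, κ, q, a′` are one-scale constants.  On the tree's scalar instance (`A = a_j`, `p = L²∕min{8,a}`, `κ² = a∕min{8,a}`, `a′ = aL⁻²`
in the matching norms, `q = 1`) this gives `γ⁻¹ = (1 + √(a∕min{8,a}))²∕a_j + 2L²∕min{8,a}` against the tree's
`(4L² + 4a∕a_j)∕min{8,a} + 2∕a_j` — the same shape, a constant factor sharper (the tree splits `(s + t)² ≤ 2s² + 2t²`; here the weights are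
optimised); by value zero weight.  TRANSFER (T-82 §3's dictionary, by shape only, nothing instantiated here): for SU(2), d = 4 the three
letters are [B9] (3.15)–(3.16) «the tower of averagings is one averaging» (`…B9Eq316TowerFlatIsOneStep`), the tower block-Poincaré
inequality (3.23) (`…B9Eq323TowerBlockPoincare`) and the covariant average's contraction (`…B11Eq155BlockLog.norm_blockAvg_le`, with the
`e^{O((dL)²ε₀)}` swelling for group-valued averages) — whether and where print's steps display them is (A3) ∕ (A1c), NC-NE7b-α UNRULED.

WHAT IS PROVED ([folklore]; ANY type `E₀ ∋ χ` of fine configurations (no norm needed), normed groups `E ∋ v` (current level) and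
`E′` (next level); ANY maps `R : E₀ → E`, `Q : E → E′`, ANY `B : E₀ → ℝ` with `B ≥ 0`):
* §1 **`sq_sum_three_le`** — the weighted Cauchy–Schwarz step `(c₁t₁ + c₂t₂ + c₃t₃)² ≤ (c₁²∕w₁ + c₂²∕w₂ + c₃²∕w₃)(w₁t₁² + w₂t₂² + w₃t₃²)`
  (`wᵢ > 0`; from `Σ_{i<j} wᵢwⱼ(uᵢtⱼ − uⱼtᵢ)² ≥ 0`); `sq_le_three_resistors` (the same behind `0 ≤ s ≤ c₁t₁ + c₂t₂ + c₃t₃`).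
* §2 **`sq_le_of_chain`** — the real-number engine: `0 ≤ n ≤ t₁ + ρ`, `ρ ≤ √(p b) + κ T`, `T ≤ q t₁ + t₄` (`b, p, κ ≥ 0`, `A, a′ > 0`) ⟹
  `n² ≤ ((1 + qκ)²∕A + p + κ²∕a′)·(A t₁² + b + a′ t₄²)`.
* §3 THE FIBRE FLOOR: **`fibreFloor_of_sqLetter`** — `0 < A`, `0 < a′`, `0 ≤ p, κ, q`, `B ≥ 0`, `‖Q x − Q y‖ ≤ q‖x − y‖`,
  `∀ χ, ‖R χ‖² ≤ p·B χ + κ²·‖Q (R χ)‖²` ⊢ `∀ v χ, ((1 + qκ)²∕A + p + κ²∕a′)⁻¹·‖v‖² ≤ A‖v − R χ‖² + B χ + a′‖Q v‖²`;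
  **`fibreFloor_of_projLetter`** — the same floor from the Poincaré letter ABOUT A PROJECTION `Pb`, `‖R χ − Pb (R χ)‖² ≤ p·B χ` with `‖Pb x‖ ≤ κ‖Q x‖`
  (block means dominated by the next average; no loss against the squared letter).
* §4 CURRENCIES: `fibreFloor_iInf` (`… ≤ (⨅ χ, (A‖v − R χ‖² + B χ)) + a′‖Q v‖²`), **`fibreFloor_of_dominates`** (AFT §5's step-letter shape:
  `T v` dominates every lower bound of `χ ↦ A‖v − R χ‖² + B χ` ⊢ `γ‖v‖² ≤ T v + a′‖Q v‖²` — the form-currency reading of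
  `γ₀ ≤ Δ^{(k)} + aL⁻²Q^*Q`), `fibreFloor_of_witness` (the tree's `form_Drs` shape: `T v = A‖v − R χ₀‖² + B χ₀` for SOME `χ₀`),
  `floorConst_pos`, **`floorConst_mono`** (the floor is monotone in `A`).
* §5 LEVEL-FREE through print's `a_k` BY NAME: **`fibreFloor_aSeq_uniform`** — with `A := B1.aSeq a L k` (`0 < a`, `1 < L`, `1 ≤ k`) the floor
  `((1 + qκ)²∕(a(1 − L⁻²)) + p + κ²∕a′)⁻¹` holds at EVERY level `k` (`B1.ainf_lt_aSeq`: `a(1 − L⁻²) < a_k`); `fibreFloor_aSeq_uniform_of_dominates`.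
* §6 OPERATOR CURRENCY: **`inner_fibreFloor_of_dominates`** — `E` a real inner-product space, `H : E →L[ℝ] E` with the one-big-step letter for
  `⟪v, H v⟫`, `Q : E →L[ℝ] E′` ⊢ `((1 + ‖Q‖κ)²∕A + p + κ²∕a′)⁻¹·‖v‖² ≤ ⟪v, H v⟫ + a′‖Q v‖²` — the `hσ` shape `…CoerciveFluctuationFloor` consumes;
  `lipschitz_letter_of_clm`.
* §7 kernel toys on `ℝ`: with `B = 0` (NO fine floor at all), `R = Q = id`, `p = 0`, `κ = q = A = a′ = 1` the theorem fires and gives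
  `(1∕5)·v² ≤ (v − χ)² + 0 + v²`; §1 is sharp on proportional data.

NOT HERE (honest): which `R, Q, B, Pb` and numbers `(A, p, κ, q, a′)` a step of print displays, in which chart and norm ((A3) ∕ (A1c));
the block-Poincaré letter itself for any lattice (Literature: `Beta.BlockPoincare`, `B5Leaf237C0Torus.block_poincare`, `B9Eq323TowerBlockPoincare`
— not restated); the Hessian-currency reading for non-quadratic actions (pointwise Schur complements: `…ConvexityModulusSchur` §3,
`…ConstrainedSchurForm`); the polymer ∕ determinant parts of the effective action (outside every floor letter).  BY-NAME EFFECT ON THE WALL: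
NONE.  NE7b NOT PRINTED ∕ NOT PROVED; spine PROVED 0∕9; rung (B)+1 on a FINITE torus — NOT infinite volume, NOT the mass gap, NOT Clay.
HONEST DEPENDENCY: continuum YM on T⁴ ⇐ BetaPertH ∧ nine spine estimates (0/9 proved); BetaPertH ⇐ (D1) ∧ (D4) ∧ CAP+tail; G-an2-4 gates
asym, D1 and NE2∕3∕4.
-/

set_option autoImplicit false

noncomputable section

namespace Summit.QuantumFields.BalabanUV.T4Continuum.NE7b.BlockPoincareFibreFloor

/-! ## §1 Three resistances in series: the weighted Cauchy–Schwarz step -/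

section CauchySchwarz

/-- Weighted Cauchy–Schwarz for three terms in CONDUCTANCE form: `(w₁u₁t₁ + w₂u₂t₂ + w₃u₃t₃)² ≤ (w₁u₁² + w₂u₂² + w₃u₃²)(w₁t₁² + w₂t₂² + w₃t₃²)`
for `wᵢ ≥ 0` — the difference is `Σ_{i<j} wᵢwⱼ(uᵢtⱼ − uⱼtᵢ)²`. [folklore] -/
theorem sq_sum_three_le_cond {w₁ w₂ w₃ : ℝ} (hw₁ : 0 ≤ w₁) (hw₂ : 0 ≤ w₂) (hw₃ : 0 ≤ w₃) (u₁ u₂ u₃ t₁ t₂ t₃ : ℝ) :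
    (w₁ * u₁ * t₁ + w₂ * u₂ * t₂ + w₃ * u₃ * t₃) ^ 2 ≤
      (w₁ * u₁ ^ 2 + w₂ * u₂ ^ 2 + w₃ * u₃ ^ 2) * (w₁ * t₁ ^ 2 + w₂ * t₂ ^ 2 + w₃ * t₃ ^ 2) := by
  nlinarith [mul_nonneg (mul_nonneg hw₁ hw₂) (sq_nonneg (u₁ * t₂ - u₂ * t₁)),
    mul_nonneg (mul_nonneg hw₁ hw₃) (sq_nonneg (u₁ * t₃ - u₃ * t₁)),
    mul_nonneg (mul_nonneg hw₂ hw₃) (sq_nonneg (u₂ * t₃ - u₃ * t₂))]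

/-- **THREE RESISTANCES IN SERIES** (weighted Cauchy–Schwarz): for `w₁, w₂, w₃ > 0`,
`(c₁t₁ + c₂t₂ + c₃t₃)² ≤ (c₁²∕w₁ + c₂²∕w₂ + c₃²∕w₃)·(w₁t₁² + w₂t₂² + w₃t₃²)`. [folklore] -/
theorem sq_sum_three_le {w₁ w₂ w₃ : ℝ} (hw₁ : 0 < w₁) (hw₂ : 0 < w₂) (hw₃ : 0 < w₃) (c₁ c₂ c₃ t₁ t₂ t₃ : ℝ) :
    (c₁ * t₁ + c₂ * t₂ + c₃ * t₃) ^ 2 ≤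
      (c₁ ^ 2 / w₁ + c₂ ^ 2 / w₂ + c₃ ^ 2 / w₃) * (w₁ * t₁ ^ 2 + w₂ * t₂ ^ 2 + w₃ * t₃ ^ 2) := by
  have key := sq_sum_three_le_cond hw₁.le hw₂.le hw₃.le (c₁ / w₁) (c₂ / w₂) (c₃ / w₃) t₁ t₂ t₃
  have e₁ : w₁ * (c₁ / w₁) = c₁ := by field_simp
  have e₂ : w₂ * (c₂ / w₂) = c₂ := by field_simp
  have e₃ : w₃ * (c₃ / w₃) = c₃ := by field_simp
  have f₁ : w₁ * (c₁ / w₁) ^ 2 = c₁ ^ 2 / w₁ := by field_simp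
  have f₂ : w₂ * (c₂ / w₂) ^ 2 = c₂ ^ 2 / w₂ := by field_simp
  have f₃ : w₃ * (c₃ / w₃) ^ 2 = c₃ ^ 2 / w₃ := by field_simp
  rw [e₁, e₂, e₃, f₁, f₂, f₃] at key
  exact key

/-- The same behind a chain `0 ≤ s ≤ c₁t₁ + c₂t₂ + c₃t₃`: `s² ≤ (c₁²∕w₁ + c₂²∕w₂ + c₃²∕w₃)·(w₁t₁² + w₂t₂² + w₃t₃²)`. [folklore] -/
theorem sq_le_three_resistors {w₁ w₂ w₃ s c₁ c₂ c₃ t₁ t₂ t₃ : ℝ} (hw₁ : 0 < w₁) (hw₂ : 0 < w₂) (hw₃ : 0 < w₃)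
    (hs0 : 0 ≤ s) (hs : s ≤ c₁ * t₁ + c₂ * t₂ + c₃ * t₃) :
    s ^ 2 ≤ (c₁ ^ 2 / w₁ + c₂ ^ 2 / w₂ + c₃ ^ 2 / w₃) * (w₁ * t₁ ^ 2 + w₂ * t₂ ^ 2 + w₃ * t₃ ^ 2) :=
  (pow_le_pow_left₀ hs0 hs 2).trans (sq_sum_three_le hw₁ hw₂ hw₃ c₁ c₂ c₃ t₁ t₂ t₃)

end CauchySchwarz

/-! ## §2 The real-number engine: two triangle inequalities and one Cauchy–Schwarz step -/

section Engine

/-- **THE ENGINE.**  Reals with `A, a′ > 0`, `p, κ ≥ 0`, `n, b ≥ 0` and the chain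
`n ≤ t₁ + ρ` (triangle: `‖v‖ ≤ ‖v − Rχ‖ + ‖Rχ‖`), `ρ ≤ √(p b) + κ T` (block Poincaré with the next constraint),
`T ≤ q t₁ + t₄` (triangle through the `q`-Lipschitz next average: `‖Q(Rχ)‖ ≤ q‖v − Rχ‖ + ‖Q v‖`; no sign of `q, t₁, t₄` needed) ⟹
`n² ≤ ((1 + qκ)²∕A + p + κ²∕a′)·(A t₁² + b + a′ t₄²)`. [folklore] -/
theorem sq_le_of_chain {n t₁ ρ b T t₄ A a' p κ q : ℝ} (hA : 0 < A) (ha' : 0 < a') (hp : 0 ≤ p) (hκ : 0 ≤ κ)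
    (hn0 : 0 ≤ n) (hb : 0 ≤ b) (hn : n ≤ t₁ + ρ) (hρ : ρ ≤ Real.sqrt (p * b) + κ * T) (hT : T ≤ q * t₁ + t₄) :
    n ^ 2 ≤ ((1 + q * κ) ^ 2 / A + p + κ ^ 2 / a') * (A * t₁ ^ 2 + b + a' * t₄ ^ 2) := by
  have hsq : Real.sqrt (p * b) = Real.sqrt p * Real.sqrt b := Real.sqrt_mul hp b
  have hκT : κ * T ≤ κ * (q * t₁ + t₄) := mul_le_mul_of_nonneg_left hT hκ
  have hchain : n ≤ (1 + q * κ) * t₁ + Real.sqrt p * Real.sqrt b + κ * t₄ := by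
    rw [hsq] at hρ
    nlinarith
  have hcs := sq_le_three_resistors (c₁ := 1 + q * κ) (c₂ := Real.sqrt p) (c₃ := κ) (t₁ := t₁) (t₂ := Real.sqrt b) (t₃ := t₄)
    hA one_pos ha' hn0 hchain
  rw [Real.sq_sqrt hp, Real.sq_sqrt hb, div_one, one_mul] at hcs
  exact hcs

/-- The floor constant is positive. [folklore] -/
theorem floorConst_pos {A a' p κ q : ℝ} (hA : 0 < A) (ha' : 0 < a') (hp : 0 ≤ p) (hκ : 0 ≤ κ) (hq : 0 ≤ q) :
    0 < ((1 + q * κ) ^ 2 / A + p + κ ^ 2 / a')⁻¹ := by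
  have : 0 < 1 + q * κ := by positivity
  positivity

/-- **THE FLOOR IS MONOTONE IN THE BIG-STEP WEIGHT `A`**: `A ≤ A′` ⟹ `γ(A) ≤ γ(A′)`. [folklore] -/
theorem floorConst_mono {A A₂ a' p κ q : ℝ} (hA : 0 < A) (hAA : A ≤ A₂) (ha' : 0 < a') (hp : 0 ≤ p) (hκ : 0 ≤ κ) (hq : 0 ≤ q) :
    ((1 + q * κ) ^ 2 / A + p + κ ^ 2 / a')⁻¹ ≤ ((1 + q * κ) ^ 2 / A₂ + p + κ ^ 2 / a')⁻¹ := by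
  have h1 : 0 < 1 + q * κ := by positivity
  have hA₂ : 0 < A₂ := lt_of_lt_of_le hA hAA
  have hle : (1 + q * κ) ^ 2 / A₂ ≤ (1 + q * κ) ^ 2 / A := div_le_div_of_nonneg_left (by positivity) hA hAA
  exact inv_anti₀ (by positivity) (by linarith)

end Engine

/-! ## §3 THE FIBRE FLOOR in normed groups -/

section Floor

variable {E₀ : Type*} {E E' : Type*} [NormedAddCommGroup E] [NormedAddCommGroup E']

/-- The `q`-Lipschitz next average carries the triangle inequality `‖Q (R χ)‖ ≤ q‖v − R χ‖ + ‖Q v‖`. [folklore] -/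
theorem norm_next_le {R : E₀ → E} {Q : E → E'} {q : ℝ} (hQ : ∀ x y : E, ‖Q x - Q y‖ ≤ q * ‖x - y‖) (v : E) (χ : E₀) :
    ‖Q (R χ)‖ ≤ q * ‖v - R χ‖ + ‖Q v‖ := by
  have h := hQ (R χ) v
  rw [norm_sub_rev (R χ) v] at h
  calc ‖Q (R χ)‖ = ‖(Q (R χ) - Q v) + Q v‖ := by rw [sub_add_cancel]
    _ ≤ ‖Q (R χ) - Q v‖ + ‖Q v‖ := norm_add_le _ _
    _ ≤ q * ‖v - R χ‖ + ‖Q v‖ := by linarith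

/-- **THE FIBRE FLOOR OF THE NEXT AVERAGING STEP (squared block-Poincaré letter with the next constraint).**  ANY type `E₀` of fine
configurations; normed groups `E` (current level), `E′` (next level); ANY maps `R : E₀ → E`, `Q : E → E′`, ANY `B : E₀ → ℝ` with `B ≥ 0`; constants
`A, a′ > 0`, `p, κ, q ≥ 0` with `‖Q x − Q y‖ ≤ q‖x − y‖` and the ONE-SCALE letter `‖R χ‖² ≤ p·B χ + κ²·‖Q (R χ)‖²` for every `χ`.
THEN for every `v : E` and `χ : E₀`:
`((1 + qκ)²∕A + p + κ²∕a′)⁻¹ · ‖v‖² ≤ A‖v − R χ‖² + B χ + a′‖Q v‖²` — a floor of the joint form in the CURRENT-level variable `v`,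
uniform in `χ`, needing NO floor of `B`. [folklore] -/
theorem fibreFloor_of_sqLetter {R : E₀ → E} {Q : E → E'} {B : E₀ → ℝ} {A a' p κ q : ℝ}
    (hA : 0 < A) (ha' : 0 < a') (hp : 0 ≤ p) (hκ : 0 ≤ κ) (hq : 0 ≤ q) (hB : ∀ χ, 0 ≤ B χ)
    (hQ : ∀ x y : E, ‖Q x - Q y‖ ≤ q * ‖x - y‖) (hP : ∀ χ, ‖R χ‖ ^ 2 ≤ p * B χ + κ ^ 2 * ‖Q (R χ)‖ ^ 2)
    (v : E) (χ : E₀) :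
    ((1 + q * κ) ^ 2 / A + p + κ ^ 2 / a')⁻¹ * ‖v‖ ^ 2 ≤ A * ‖v - R χ‖ ^ 2 + B χ + a' * ‖Q v‖ ^ 2 := by
  have hT : ‖Q (R χ)‖ ≤ q * ‖v - R χ‖ + ‖Q v‖ := norm_next_le hQ v χ
  have hρ : ‖R χ‖ ≤ Real.sqrt (p * B χ) + κ * ‖Q (R χ)‖ := by
    have hpb : 0 ≤ p * B χ := mul_nonneg hp (hB χ)
    have hrhs : 0 ≤ Real.sqrt (p * B χ) + κ * ‖Q (R χ)‖ := by positivity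
    have h1 : ‖R χ‖ ^ 2 ≤ (Real.sqrt (p * B χ) + κ * ‖Q (R χ)‖) ^ 2 := by
      have e : (Real.sqrt (p * B χ) + κ * ‖Q (R χ)‖) ^ 2 =
          p * B χ + κ ^ 2 * ‖Q (R χ)‖ ^ 2 + 2 * (Real.sqrt (p * B χ) * (κ * ‖Q (R χ)‖)) := by
        rw [add_sq, Real.sq_sqrt hpb]; ring
      rw [e]
      nlinarith [hP χ, Real.sqrt_nonneg (p * B χ), mul_nonneg hκ (norm_nonneg (Q (R χ)))]
    exact (pow_le_pow_iff_left₀ (norm_nonneg _) hrhs two_ne_zero).1 h1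
  have hn : ‖v‖ ≤ ‖v - R χ‖ + ‖R χ‖ := by
    calc ‖v‖ = ‖(v - R χ) + R χ‖ := by rw [sub_add_cancel]
      _ ≤ ‖v - R χ‖ + ‖R χ‖ := norm_add_le _ _
  have key := sq_le_of_chain hA ha' hp hκ (norm_nonneg v) (hB χ) hn hρ hT
  have hΓ : 0 < (1 + q * κ) ^ 2 / A + p + κ ^ 2 / a' := by
    have : 0 < 1 + q * κ := by positivity
    positivity
  rw [inv_mul_le_iff₀ hΓ]
  exact key

/-- **THE SAME FLOOR FROM THE POINCARÉ LETTER ABOUT A PROJECTION.**  With ANY map `Pb : E → E` («block-constant part» Π), the letters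
`‖R χ − Pb (R χ)‖² ≤ p·B χ` (one-scale block Poincaré for the averaged field) and `‖Pb x‖ ≤ κ‖Q x‖` (block means are dominated by the
next average) give the floor `((1 + qκ)²∕A + p + κ²∕a′)⁻¹` — no loss against the squared letter. [folklore] -/
theorem fibreFloor_of_projLetter {R : E₀ → E} {Q : E → E'} {Pb : E → E} {B : E₀ → ℝ} {A a' p κ q : ℝ}
    (hA : 0 < A) (ha' : 0 < a') (hp : 0 ≤ p) (hκ : 0 ≤ κ) (hq : 0 ≤ q) (hB : ∀ χ, 0 ≤ B χ)
    (hQ : ∀ x y : E, ‖Q x - Q y‖ ≤ q * ‖x - y‖) (hPb : ∀ x : E, ‖Pb x‖ ≤ κ * ‖Q x‖)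
    (hP : ∀ χ, ‖R χ - Pb (R χ)‖ ^ 2 ≤ p * B χ) (v : E) (χ : E₀) :
    ((1 + q * κ) ^ 2 / A + p + κ ^ 2 / a')⁻¹ * ‖v‖ ^ 2 ≤ A * ‖v - R χ‖ ^ 2 + B χ + a' * ‖Q v‖ ^ 2 := by
  have hT : ‖Q (R χ)‖ ≤ q * ‖v - R χ‖ + ‖Q v‖ := norm_next_le hQ v χ
  have hρ : ‖R χ‖ ≤ Real.sqrt (p * B χ) + κ * ‖Q (R χ)‖ := by
    have h1 : ‖R χ - Pb (R χ)‖ ≤ Real.sqrt (p * B χ) := Real.le_sqrt_of_sq_le (hP χ)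
    calc ‖R χ‖ = ‖(R χ - Pb (R χ)) + Pb (R χ)‖ := by rw [sub_add_cancel]
      _ ≤ ‖R χ - Pb (R χ)‖ + ‖Pb (R χ)‖ := norm_add_le _ _
      _ ≤ Real.sqrt (p * B χ) + κ * ‖Q (R χ)‖ := add_le_add h1 (hPb _)
  have hn : ‖v‖ ≤ ‖v - R χ‖ + ‖R χ‖ := by
    calc ‖v‖ = ‖(v - R χ) + R χ‖ := by rw [sub_add_cancel]
      _ ≤ ‖v - R χ‖ + ‖R χ‖ := norm_add_le _ _
  have key := sq_le_of_chain hA ha' hp hκ (norm_nonneg v) (hB χ) hn hρ hT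
  have hΓ : 0 < (1 + q * κ) ^ 2 / A + p + κ ^ 2 / a' := by
    have : 0 < 1 + q * κ := by positivity
    positivity
  rw [inv_mul_le_iff₀ hΓ]
  exact key

/-! ## §4 Currencies: `⨅`, «dominates every lower bound» (AFT §5's step letter), witness (the tree's `form_Drs` shape) -/

/-- `⨅`-CURRENCY (`E₀` non-empty): `γ‖v‖² ≤ (⨅ χ, (A‖v − R χ‖² + B χ)) + a′‖Q v‖²` — the floor of the base form of the ONE BIG STEP
plus the next penalty. [folklore] -/
theorem fibreFloor_iInf [Nonempty E₀] {R : E₀ → E} {Q : E → E'} {B : E₀ → ℝ} {A a' p κ q : ℝ}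
    (hA : 0 < A) (ha' : 0 < a') (hp : 0 ≤ p) (hκ : 0 ≤ κ) (hq : 0 ≤ q) (hB : ∀ χ, 0 ≤ B χ)
    (hQ : ∀ x y : E, ‖Q x - Q y‖ ≤ q * ‖x - y‖) (hP : ∀ χ, ‖R χ‖ ^ 2 ≤ p * B χ + κ ^ 2 * ‖Q (R χ)‖ ^ 2) (v : E) :
    ((1 + q * κ) ^ 2 / A + p + κ ^ 2 / a')⁻¹ * ‖v‖ ^ 2 ≤ (⨅ χ : E₀, (A * ‖v - R χ‖ ^ 2 + B χ)) + a' * ‖Q v‖ ^ 2 := by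
  have h : ∀ χ : E₀, ((1 + q * κ) ^ 2 / A + p + κ ^ 2 / a')⁻¹ * ‖v‖ ^ 2 - a' * ‖Q v‖ ^ 2 ≤ A * ‖v - R χ‖ ^ 2 + B χ :=
    fun χ => by linarith [fibreFloor_of_sqLetter hA ha' hp hκ hq hB hQ hP v χ]
  linarith [le_ciInf h]

/-- **«DOMINATES» CURRENCY — THE FORM READING OF `γ₀ ≤ Δ^{(k)} + aL⁻²Q^*Q`**: if the current-level form `T` dominates every lower bound of
`χ ↦ A‖v − R χ‖² + B χ` (the ONE-BIG-STEP letter; AFT §5's `hstep` shape), then `γ‖v‖² ≤ T v + a′‖Q v‖²` for every `v`, with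
`γ = ((1 + qκ)²∕A + p + κ²∕a′)⁻¹`. [folklore] -/
theorem fibreFloor_of_dominates {R : E₀ → E} {Q : E → E'} {B : E₀ → ℝ} {T : E → ℝ} {A a' p κ q : ℝ}
    (hA : 0 < A) (ha' : 0 < a') (hp : 0 ≤ p) (hκ : 0 ≤ κ) (hq : 0 ≤ q) (hB : ∀ χ, 0 ≤ B χ)
    (hQ : ∀ x y : E, ‖Q x - Q y‖ ≤ q * ‖x - y‖) (hP : ∀ χ, ‖R χ‖ ^ 2 ≤ p * B χ + κ ^ 2 * ‖Q (R χ)‖ ^ 2)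
    (hT : ∀ (v : E) (c : ℝ), (∀ χ, c ≤ A * ‖v - R χ‖ ^ 2 + B χ) → c ≤ T v) (v : E) :
    ((1 + q * κ) ^ 2 / A + p + κ ^ 2 / a')⁻¹ * ‖v‖ ^ 2 ≤ T v + a' * ‖Q v‖ ^ 2 := by
  have h := hT v (((1 + q * κ) ^ 2 / A + p + κ ^ 2 / a')⁻¹ * ‖v‖ ^ 2 - a' * ‖Q v‖ ^ 2)
    (fun χ => by linarith [fibreFloor_of_sqLetter hA ha' hp hκ hq hB hQ hP v χ])
  linarith

/-- WITNESS CURRENCY (the tree's `B4Ineq115Torus.form_Drs` shape: the level form is ATTAINED in the big step by some fine configuration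
`χ₀`, `A‖v − R χ₀‖² + B χ₀ ≤ T v`): `γ‖v‖² ≤ T v + a′‖Q v‖²`. [folklore] -/
theorem fibreFloor_of_witness {R : E₀ → E} {Q : E → E'} {B : E₀ → ℝ} {T : E → ℝ} {A a' p κ q : ℝ}
    (hA : 0 < A) (ha' : 0 < a') (hp : 0 ≤ p) (hκ : 0 ≤ κ) (hq : 0 ≤ q) (hB : ∀ χ, 0 ≤ B χ)
    (hQ : ∀ x y : E, ‖Q x - Q y‖ ≤ q * ‖x - y‖) (hP : ∀ χ, ‖R χ‖ ^ 2 ≤ p * B χ + κ ^ 2 * ‖Q (R χ)‖ ^ 2)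
    (hT : ∀ v : E, ∃ χ, A * ‖v - R χ‖ ^ 2 + B χ ≤ T v) (v : E) :
    ((1 + q * κ) ^ 2 / A + p + κ ^ 2 / a')⁻¹ * ‖v‖ ^ 2 ≤ T v + a' * ‖Q v‖ ^ 2 := by
  obtain ⟨χ, hχ⟩ := hT v
  linarith [fibreFloor_of_sqLetter hA ha' hp hκ hq hB hQ hP v χ]

end Floor

/-! ## §5 LEVEL-FREE through print's `a_k` BY NAME (`…Balaban1983to89.B1.aSeq`, [Balaban1982Higgs1] (2.13)–(2.15) p. 609) -/

section Uniform

open Literature.MathematicalPhysics.QuantumFieldTheory.Balaban1983to89.B1 (aSeq aSeq_pos ainf_lt_aSeq)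

variable {E₀ : Type*} {E E' : Type*} [NormedAddCommGroup E] [NormedAddCommGroup E']

/-- **THE FIBRE FLOOR IS LEVEL-FREE**: with the big-step weight `A := a_k = B1.aSeq a L k` (`0 < a`, `1 < L`, `1 ≤ k`) the floor
`((1 + qκ)²∕(a(1 − L⁻²)) + p + κ²∕a′)⁻¹` — the value at `a_∞ = a(1 − L⁻²) < a_k` (`B1.ainf_lt_aSeq`) — holds at EVERY level `k`:
`γ_∞‖v‖² ≤ a_k‖v − R χ‖² + B χ + a′‖Q v‖²`. [folklore] (junction BY NAME; nothing of print's asserted) -/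
theorem fibreFloor_aSeq_uniform {R : E₀ → E} {Q : E → E'} {B : E₀ → ℝ} {a L a' p κ q : ℝ}
    (ha : 0 < a) (hL : 1 < L) {k : ℕ} (hk : 1 ≤ k) (ha' : 0 < a') (hp : 0 ≤ p) (hκ : 0 ≤ κ) (hq : 0 ≤ q) (hB : ∀ χ, 0 ≤ B χ)
    (hQ : ∀ x y : E, ‖Q x - Q y‖ ≤ q * ‖x - y‖) (hP : ∀ χ, ‖R χ‖ ^ 2 ≤ p * B χ + κ ^ 2 * ‖Q (R χ)‖ ^ 2)
    (v : E) (χ : E₀) :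
    ((1 + q * κ) ^ 2 / (a * (1 - (L ^ 2)⁻¹)) + p + κ ^ 2 / a')⁻¹ * ‖v‖ ^ 2 ≤
      aSeq a L k * ‖v - R χ‖ ^ 2 + B χ + a' * ‖Q v‖ ^ 2 := by
  -- `a_∞ = a(1 − L⁻²) > 0` (the tree's `B4Ineq116Torus.ainf_pos`, inlined to keep the import cone at `B1`)
  have hainf : 0 < a * (1 - (L ^ 2)⁻¹) := by
    have h2 : 1 < L ^ 2 := by nlinarith
    have : (L ^ 2)⁻¹ < 1 := inv_lt_one_of_one_lt₀ h2
    exact mul_pos ha (by linarith)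
  have hmono := floorConst_mono hainf (ainf_lt_aSeq ha hL k hk).le ha' hp hκ hq
  have hfl := fibreFloor_of_sqLetter (aSeq_pos ha hL hk) ha' hp hκ hq hB hQ hP v χ
  exact le_trans (mul_le_mul_of_nonneg_right hmono (sq_nonneg _)) hfl

/-- The level-free floor in «dominates» currency: a TOWER of current-level forms `T k` (each dominating every lower bound of its
ONE BIG STEP from the fine level with weight `a_k`, all `k ≥ 1`) satisfies `γ_∞‖v‖² ≤ T k v + a′‖Q k v‖²` at every level with
ONE constant `γ_∞ = ((1 + qκ)²∕(a(1 − L⁻²)) + p + κ²∕a′)⁻¹` — provided the one-scale letters `p, κ, q, a′` are level-free. [folklore] -/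
theorem fibreFloor_aSeq_uniform_of_dominates {Ek : ℕ → Type*} {Ek' : ℕ → Type*}
    [∀ k, NormedAddCommGroup (Ek k)] [∀ k, NormedAddCommGroup (Ek' k)]
    {R : (k : ℕ) → E₀ → Ek k} {Q : (k : ℕ) → Ek k → Ek' k} {B : E₀ → ℝ} {T : (k : ℕ) → Ek k → ℝ} {a L a' p κ q : ℝ}
    (ha : 0 < a) (hL : 1 < L) (ha' : 0 < a') (hp : 0 ≤ p) (hκ : 0 ≤ κ) (hq : 0 ≤ q) (hB : ∀ χ, 0 ≤ B χ)
    (hQ : ∀ k, ∀ x y : Ek k, ‖Q k x - Q k y‖ ≤ q * ‖x - y‖)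
    (hP : ∀ k, ∀ χ, ‖R k χ‖ ^ 2 ≤ p * B χ + κ ^ 2 * ‖Q k (R k χ)‖ ^ 2)
    (hT : ∀ k, 1 ≤ k → ∀ (v : Ek k) (c : ℝ), (∀ χ, c ≤ aSeq a L k * ‖v - R k χ‖ ^ 2 + B χ) → c ≤ T k v)
    {k : ℕ} (hk : 1 ≤ k) (v : Ek k) :
    ((1 + q * κ) ^ 2 / (a * (1 - (L ^ 2)⁻¹)) + p + κ ^ 2 / a')⁻¹ * ‖v‖ ^ 2 ≤ T k v + a' * ‖Q k v‖ ^ 2 := by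
  have h := hT k hk v (((1 + q * κ) ^ 2 / (a * (1 - (L ^ 2)⁻¹)) + p + κ ^ 2 / a')⁻¹ * ‖v‖ ^ 2 - a' * ‖Q k v‖ ^ 2)
    (fun χ => by linarith [fibreFloor_aSeq_uniform ha hL hk ha' hp hκ hq hB (hQ k) (hP k) v χ])
  linarith

end Uniform

/-! ## §6 OPERATOR CURRENCY: continuous linear `Q`, quadratic `T v = ⟪v, H v⟫` — the road's `hσ` letter shape -/

section Operator

open RealInnerProductSpace

variable {E₀ : Type*} {E E' : Type*} [NormedAddCommGroup E] [NormedAddCommGroup E']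

/-- A continuous linear next average is `‖Q‖`-Lipschitz in the letter's shape: `‖Q x − Q y‖ ≤ ‖Q‖·‖x − y‖`. [folklore] -/
theorem lipschitz_letter_of_clm [NormedSpace ℝ E] [NormedSpace ℝ E'] (Q : E →L[ℝ] E') (x y : E) :
    ‖Q x - Q y‖ ≤ ‖Q‖ * ‖x - y‖ := by
  rw [← map_sub]; exact Q.le_opNorm _

/-- **OPERATOR CURRENCY — THE ROAD's `hσ` LETTER FOR THE FLUCTUATION OPERATOR.**  `E` a real inner-product space, `H : E →L[ℝ] E` with the
ONE-BIG-STEP letter in form currency («`⟪v, H v⟫` dominates every lower bound of `χ ↦ A‖v − R χ‖² + B χ`»), `Q : E →L[ℝ] E′` continuous linear,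
and the one-scale letter `‖R χ‖² ≤ p·B χ + κ²‖Q (R χ)‖²` ⊢ `((1 + ‖Q‖κ)²∕A + p + κ²∕a′)⁻¹·‖v‖² ≤ ⟪v, H v⟫ + a′‖Q v‖²` for every `v` — the shape
`σ‖v‖² ≤ ⟪v, (H + a′Q^*Q) v⟫` that `…CoerciveFluctuationFloor` ∕ `…ScalarTowerFibreFloor` consume (`‖Q v‖² = ⟪v, Q^*Q v⟫`). [folklore] -/
theorem inner_fibreFloor_of_dominates [InnerProductSpace ℝ E] [NormedSpace ℝ E'] {R : E₀ → E} (H : E →L[ℝ] E) (Q : E →L[ℝ] E')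
    {B : E₀ → ℝ} {A a' p κ : ℝ} (hA : 0 < A) (ha' : 0 < a') (hp : 0 ≤ p) (hκ : 0 ≤ κ) (hB : ∀ χ, 0 ≤ B χ)
    (hP : ∀ χ, ‖R χ‖ ^ 2 ≤ p * B χ + κ ^ 2 * ‖Q (R χ)‖ ^ 2)
    (hH : ∀ (v : E) (c : ℝ), (∀ χ, c ≤ A * ‖v - R χ‖ ^ 2 + B χ) → c ≤ ⟪v, H v⟫) (v : E) :
    ((1 + ‖Q‖ * κ) ^ 2 / A + p + κ ^ 2 / a')⁻¹ * ‖v‖ ^ 2 ≤ ⟪v, H v⟫ + a' * ‖Q v‖ ^ 2 :=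
  fibreFloor_of_dominates (T := fun v => ⟪v, H v⟫) hA ha' hp hκ (norm_nonneg Q) hB (lipschitz_letter_of_clm Q) hP hH v

end Operator

/-! ## §7 Kernel toys on `ℝ`: the letters are jointly inhabited with `B = 0` (no fine floor at all), and §1 is sharp -/

/-- Toy (MASSLESS CARICATURE): `E₀ = E = E′ = ℝ`, `R = Q = id`, `B = 0`, `p = 0`, `κ = q = A = a′ = 1`: the one-scale letter reads
`‖χ‖² ≤ 0·0 + 1·‖χ‖²`, the next average is `1`-Lipschitz, and the theorem FIRES with `γ = ((1+1)²∕1 + 0 + 1∕1)⁻¹ = 1∕5`: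
`(1∕5)·v² ≤ (v − χ)² + 0 + v²` for all real `v, χ` — a floor with NO coercivity of `B` whatsoever. -/
example (v χ : ℝ) : ((1 + (1 : ℝ) * 1) ^ 2 / 1 + 0 + (1 : ℝ) ^ 2 / 1)⁻¹ * ‖v‖ ^ 2 ≤
    1 * ‖v - id χ‖ ^ 2 + (fun _ : ℝ => (0 : ℝ)) χ + 1 * ‖id v‖ ^ 2 :=
  fibreFloor_of_sqLetter (E₀ := ℝ) (E := ℝ) (E' := ℝ) (R := id) (Q := id) (B := fun _ => 0)
    one_pos one_pos le_rfl zero_le_one zero_le_one (fun _ => le_rfl) (fun x y => by simp)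
    (fun χ => by simp) v χ

/-- The toy's constant is `1∕5` and the displayed inequality is the elementary `v²∕5 ≤ (v − χ)² + v²`. -/
example (v χ : ℝ) : (1 / 5 : ℝ) * v ^ 2 ≤ (v - χ) ^ 2 + v ^ 2 := by nlinarith [sq_nonneg (v - χ), sq_nonneg v]

/-- §1 is SHARP: equality for proportional data (`tᵢ = cᵢ∕wᵢ`), here `c = (1,1,1)`, `w = (1,1,1)`, `t = (1,1,1)`: `9 = 3·3`. -/
example : ((1 : ℝ) * 1 + 1 * 1 + 1 * 1) ^ 2 = (1 ^ 2 / 1 + 1 ^ 2 / 1 + 1 ^ 2 / 1) * (1 * 1 ^ 2 + 1 * 1 ^ 2 + 1 * 1 ^ 2) := by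
  norm_num

end Summit.QuantumFields.BalabanUV.T4Continuum.NE7b.BlockPoincareFibreFloor
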